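import Summits.QuantumFields.YangMills.Theorems.AtomicCalibrationRSmearedCompactness
import Summits.QuantumFields.YangMills.Theorems.InfiniteVolumeContinuumIVEuclideanInvarianceSigned
import Summits.QuantumFields.YangMills.Theorems.BalabanLadderInfVolRPSeries
import Summits.QuantumFields.YangMills.Theorems.LangevinControlUVOSLegsFromFemtoAndGapStubAssemblyHermitian
import Summits.QuantumFields.YangMills.Theorems.InfiniteVolumePermutations
import HarnessLib

/-!
# AtomicCalibrationR (stmt-QuantumFields-28169), B7 `stub_smearedIVData` — second brick: the DATA-ONLY Osterwalder–Schrader clauses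
# (planner ym-idea-11 g15's `STUB-PLAN-smearedIVData.md`, steps 5–7 except translations; prover w4 g23, free hands)

Every clause of the leaf `InfiniteVolumeContinuum.HypercubicOSDataFromInfiniteVolume` that follows from the DATA tuple alone
(`β_k`, `μ_k ∈ oddTorusLimitPoints r β_k`, `S₁ 0 = eval`, `S₁ 1 = 0`, `S₁ n = Σ_q T n q`, convergence of the centre-smeared
functionals on `⁰𝒮`) — i.e. WITHOUT the pointwise collar `MomentBounds6` — is collected here for the smeared engine (`smearedData`):

* `smeared_osClauses` — E0 `IsNormalized`; E2 `IsReflectionPositive` (`InfVolRP.rpPos_of_oddTorusLimitStates_centre`, time-ordered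
  tests are off-diagonal); hermiticity (`OSLegsFromFemtoAndGap.isHermitian_of_isReflectionPositive`); the exact hyperoctahedral `W₄`
  invariance on `⁰𝒮` (`InfiniteVolume.E1.stub_ivSigned`, lattice symmetries of odd-torus limit states); E3 `IsSymmetric`
  (`InfiniteVolume.sum_limit_permTest_eq`); and E0′ `HasLinearGrowth` from the smeared bound `‖S₁ n F‖ ≤ 6ⁿ·max 1 (c n)·‖F‖_{Nn}` with
  `c n ≤ α Cⁿ (n!)^γ` (`(6M)ⁿ ≤ e^{6M}·n!`).

What B7 still needs: translation invariance on `⁰𝒮` (smeared twin of `translate_eq_of_tendsto`) and NT/NG from the floors (torus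
junction).  HONEST FRAMING: soft analysis on HYPOTHESES; nothing about Bałaban's RG, a mass gap or Clay; no summit is proved. [folklore]
References: Osterwalder–Schrader CMP 31 (1973) §3, CMP 42 (1975) §2; Glimm–Jaffe (1987) §6.1.
-/

set_option autoImplicit false

noncomputable section

open scoped BigOperators SchwartzMap
open MeasureTheory Filter Topology
open Literature.MathematicalPhysics.QuantumFieldTheory hiding ZdEdge
open Literature.MathematicalPhysics.QuantumLattice
open Literature.MathematicalPhysics.AQFT
open Literature.Probability.LatticeModels (box Site)
open Summit.QuantumFields.YangMills.Cruxes.OSLegsFromFemtoAndGap.DlrCollarTransfer (RPPos)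
open Summit.QuantumFields.YangMills.Theorems.InfiniteVolume (stateMomentStr sum_limit_permTest_eq)
open Summit.QuantumFields.YangMills.Theorems.InfVolRP (centreOffset rpPos_of_oddTorusLimitStates_centre)
open Summit.QuantumFields.YangMills.Theorems.OSLegsFromFemtoAndGap (isHermitian_of_isReflectionPositive)

namespace Summit.QuantumFields.YangMills.Cruxes.AtomicCalibrationR.SmearedOSClauses

variable {G : Type} [Group G] [TopologicalSpace G] [IsTopologicalGroup G] [CompactSpace G]
  [MeasurableSpace G] [BorelSpace G]

/-- **E0′ from an admissible smeared bound**: `‖S₁ n F‖ ≤ 6ⁿ·max 1 (c n)·‖F‖_{Nn}` with `c n ≤ α Cⁿ (n!)^γ` gives OS linear growth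
(`(6M)ⁿ ≤ e^{6M}·n!`, `M = max 1 C`). -/
theorem hasLinearGrowth_of_smeared_bound (S₁ : SchwingerFamily (EuclideanSpace ℝ (Fin 4))) (c : ℕ → ℝ) (N : ℕ)
    (hS₁bd : ∀ (n : ℕ) (F : 𝓢((Fin n → EuclideanSpace ℝ (Fin 4)), ℂ)),
      ‖S₁ n F‖ ≤ 6 ^ n * max 1 (c n) * schwartzNorm (N * n) F)
    {α₀ C₀ γ₀ : ℝ} (hα₀ : 0 ≤ α₀) (hC₀ : 0 ≤ C₀) (hc : ∀ n, c n ≤ α₀ * C₀ ^ n * (n.factorial : ℝ) ^ γ₀) :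
    S₁.toLabelled.HasLinearGrowth := by
  intro _
  set M : ℝ := max 1 C₀ with hM
  have hM1 : 1 ≤ M := le_max_left _ _
  have hM0 : 0 ≤ M := zero_le_one.trans hM1
  refine ⟨N, (1 + α₀) * Real.exp (6 * M), max γ₀ 0 + 1, fun n k _ F _ => ?_⟩
  rw [SchwingerFamily.toLabelled_apply, Nat.mul_comm n N]
  have hfac1 : (1 : ℝ) ≤ (n.factorial : ℝ) := by exact_mod_cast Nat.one_le_iff_ne_zero.2 (Nat.factorial_ne_zero n)
  have hfac0 : (0 : ℝ) < (n.factorial : ℝ) := by positivity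
  have hSN : 0 ≤ schwartzNorm (N * n) F := schwartzNorm_nonneg _ _
  -- `max 1 (c n) ≤ (1 + α₀) Mⁿ (n!)^γ'`, `γ' = max γ₀ 0`
  have hpowγ : (n.factorial : ℝ) ^ γ₀ ≤ (n.factorial : ℝ) ^ max γ₀ 0 :=
    Real.rpow_le_rpow_of_exponent_le hfac1 (le_max_left _ _)
  have hγ1 : (1 : ℝ) ≤ (n.factorial : ℝ) ^ max γ₀ 0 := Real.one_le_rpow hfac1 (le_max_right _ _)
  have hMn1 : (1 : ℝ) ≤ M ^ n := one_le_pow₀ hM1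
  have hCM : C₀ ^ n ≤ M ^ n := pow_le_pow_left₀ hC₀ (le_max_right _ _) n
  have hmax : max 1 (c n) ≤ (1 + α₀) * M ^ n * (n.factorial : ℝ) ^ max γ₀ 0 := by
    refine max_le ?_ ?_
    · calc (1 : ℝ) = 1 * 1 * 1 := by ring
        _ ≤ (1 + α₀) * M ^ n * (n.factorial : ℝ) ^ max γ₀ 0 :=
          mul_le_mul (mul_le_mul (by linarith) hMn1 zero_le_one (by linarith)) hγ1 zero_le_one (by positivity)
    · calc c n ≤ α₀ * C₀ ^ n * (n.factorial : ℝ) ^ γ₀ := hc n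
        _ ≤ (1 + α₀) * M ^ n * (n.factorial : ℝ) ^ max γ₀ 0 :=
          mul_le_mul (mul_le_mul (by linarith) hCM (pow_nonneg hC₀ n) (by linarith)) hpowγ (by positivity) (by positivity)
  -- `(6M)ⁿ ≤ e^{6M} n!`
  have hexp : (6 * M) ^ n ≤ Real.exp (6 * M) * (n.factorial : ℝ) := by
    have h := Real.pow_div_factorial_le_exp (x := 6 * M) (by positivity) n
    rwa [div_le_iff₀ hfac0] at h
  have hrpow : (n.factorial : ℝ) * (n.factorial : ℝ) ^ max γ₀ 0 = (n.factorial : ℝ) ^ (max γ₀ 0 + 1) := by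
    rw [Real.rpow_add_one hfac0.ne', mul_comm]
  calc ‖S₁ n F‖ ≤ 6 ^ n * max 1 (c n) * schwartzNorm (N * n) F := hS₁bd n F
    _ ≤ 6 ^ n * ((1 + α₀) * M ^ n * (n.factorial : ℝ) ^ max γ₀ 0) * schwartzNorm (N * n) F := by gcongr
    _ = (1 + α₀) * (6 * M) ^ n * (n.factorial : ℝ) ^ max γ₀ 0 * schwartzNorm (N * n) F := by rw [mul_pow]; ring
    _ ≤ (1 + α₀) * (Real.exp (6 * M) * (n.factorial : ℝ)) * (n.factorial : ℝ) ^ max γ₀ 0 * schwartzNorm (N * n) F := by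
        gcongr
    _ = (1 + α₀) * Real.exp (6 * M) * (n.factorial : ℝ) ^ (max γ₀ 0 + 1) * schwartzNorm (N * n) F := by
        rw [← hrpow]; ring

/-- **THE DATA-ONLY OS CLAUSES of the smeared engine.**  See the module docstring. [folklore] -/
theorem smeared_osClauses (r : LatticeRep G) (a : ℝ → ℝ) (hapos : ∀ β, 0 < a β) (β : ℕ → ℝ) (hβ : Tendsto β atTop atTop)
    (haβ0 : Tendsto (fun k => a (β k)) atTop (𝓝 0)) (μ : ℕ → Measure (LGConfig 4 G))
    (S₁ : SchwingerFamily (EuclideanSpace ℝ (Fin 4)))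
    (T : (n : ℕ) → (Fin n → Fin 4 × Fin 4) → (𝓢((Fin n → EuclideanSpace ℝ (Fin 4)), ℂ) →L[ℂ] ℂ))
    (hμ : ∀ k, μ k ∈ oddTorusLimitPoints r (β k))
    (h0 : ∀ F : 𝓢((Fin 0 → EuclideanSpace ℝ (Fin 4)), ℂ), S₁ 0 F = F default)
    (h1 : ∀ F : 𝓢((Fin 1 → EuclideanSpace ℝ (Fin 4)), ℂ), S₁ 1 F = 0)
    (hS : ∀ n : ℕ, 2 ≤ n → ∀ F : 𝓢((Fin n → EuclideanSpace ℝ (Fin 4)), ℂ),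
      S₁ n F = ∑ q ∈ Fintype.piFinset (fun _ : Fin n => Finset.univ.filter fun p : Fin 4 × Fin 4 => p.1 < p.2), T n q F)
    (hT : ∀ n : ℕ, 2 ≤ n → ∀ q : Fin n → Fin 4 × Fin 4, (∀ i, (q i).1 < (q i).2) →
      ∀ F : 𝓢((Fin n → EuclideanSpace ℝ (Fin 4)), ℂ), IsOffDiagonal F →
        Tendsto (fun k => ∑' x : Fin n → (Fin 4 → ℤ), ((stateMomentStr G r (μ k) n q x : ℝ) : ℂ) *
          F (fun l => a (β k) • siteToE (x l) +
            (a (β k) / 2) • (EuclideanSpace.single (q l).1 (1 : ℝ) + EuclideanSpace.single (q l).2 (1 : ℝ))))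
          atTop (𝓝 (T n q F))) :
    S₁.toLabelled.IsNormalized ∧ S₁.toLabelled.IsReflectionPositive ∧ S₁.toLabelled.IsHermitian ∧
      (∀ R : EuclideanSpace ℝ (Fin 4) ≃ₗᵢ[ℝ] EuclideanSpace ℝ (Fin 4),
        (∀ i : Fin 4, ∃ j : Fin 4, R (EuclideanSpace.single i (1 : ℝ)) = EuclideanSpace.single j (1 : ℝ) ∨
          R (EuclideanSpace.single i (1 : ℝ)) = -EuclideanSpace.single j (1 : ℝ)) →
        ∀ (n : ℕ) (F : 𝓢((Fin n → EuclideanSpace ℝ (Fin 4)), ℂ)), IsOffDiagonal F → S₁ n (linActMulti R F) = S₁ n F) ∧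
      S₁.toLabelled.IsSymmetric := by
  classical
  -- a faithful continuous matrix representation of the compact group makes it Hausdorff and second countable
  haveI : T2Space G := (r.continuous.isClosedEmbedding r.injective).isEmbedding.t2Space
  haveI : SecondCountableTopology G :=
    (r.continuous.isClosedEmbedding r.injective).isEmbedding.secondCountableTopology
  -- E0
  have hN : S₁.toLabelled.IsNormalized := fun _ F => by
    rw [SchwingerFamily.toLabelled_apply, h0]
    exact congrArg F (Subsingleton.elim _ _)
  -- E2 (the centre-smeared series in the `centreOffset` spelling)
  have hβev : ∀ᶠ k in atTop, 0 ≤ β k := hβ.eventually_ge_atTop 0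
  have hRP : RPPos S₁ ∧ S₁.toLabelled.IsReflectionPositive := by
    refine rpPos_of_oddTorusLimitStates_centre r hβev μ hμ (fun k => hapos (β k)) haβ0 T (fun n hn q hq F hF => ?_) S₁ hS
      h0 h1
    have hpt : ∀ (k : ℕ) (x : Fin n → Site 4),
        (fun l => a (β k) • (siteToE (x l) + centreOffset (q l))) =
          fun l => a (β k) • siteToE (x l) +
            (a (β k) / 2) • (EuclideanSpace.single (q l).1 (1 : ℝ) + EuclideanSpace.single (q l).2 (1 : ℝ)) :=
      fun k x => funext fun l => by
        -- the two spellings of the plaquette centre (`InfiniteVolumeContinuum.centre_point_eq`)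
        unfold centreOffset
        rw [if_pos (hq l), smul_add, smul_smul, mul_one_div]
    simp_rw [hpt]
    exact hT n hn q hq F hF
  -- W₄ on ⁰𝒮 (exact lattice symmetries passing to the limit)
  have hW4 := Summit.QuantumFields.YangMills.Theorems.InfiniteVolume.E1.stub_ivSigned r a β μ S₁ T hapos hμ h0 h1 hS hT
  refine ⟨hN, hRP.2, isHermitian_of_isReflectionPositive S₁ hN hRP.2, fun R hR n F hF => hW4 R hR n F hF, ?_⟩
  -- E3
  intro n k π F hF
  simp only [SchwingerFamily.toLabelled_apply]
  rcases Nat.lt_or_ge n 2 with hn | hn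
  · interval_cases n
    · rw [h0, h0]
      exact (permTest_apply π F default).trans (congrArg F (Subsingleton.elim _ _))
    · rw [h1, h1]
  · rw [hS n hn, hS n hn]
    exact sum_limit_permTest_eq r μ (fun k => a (β k))
      (fun k p => (a (β k) / 2) • (EuclideanSpace.single p.1 (1 : ℝ) + EuclideanSpace.single p.2 (1 : ℝ)))
      (fun q F => T n q F) (fun q hq F' hF' => hT n hn q hq F' hF') π F hF

end Summit.QuantumFields.YangMills.Cruxes.AtomicCalibrationR.SmearedOSClauses

end
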